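import Literature.Barriers.BirchSwinnertonDyer.PAdicFunctionalEquationParityProofs
import Literature.NumberTheory.EllipticCurves.Sprung2017.SharpFlatFunctionalEquation
import Literature.NumberTheory.EllipticCurves.Kobayashi2003.SignedSelmerCorankBoundProofs
import Summits.BirchSwinnertonDyer.Rank1Residual.Supersingular.SprungPollackConsistency
import Summits.BirchSwinnertonDyer.Rank1Residual.Supersingular.SqueezeCertificates
import HarnessLib

/-!
# Route `SignedLowerHalves`, crux 3 `KobayashiLowerHalfLargeImage` (item stmt-BirchSwinnertonDyer-19001):
# the PARITY STRATUM — Kobayashi's Eisenstein half `KobayashiLowerDivisibility W p ε` holds at EVERY pair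
# whose signed `p`-adic `L`-function has `μ(L_p^ε) = 0` and `λ(L_p^ε) ≤ 1`, with NO rank hypothesis
# (cell `bsd-ssimc`, seat `bsd-line-slh-p1` LEAD gen 12; helper file `--supports 19001`; executes the
# support suggestion §4 of `Cruxes/KobayashiLowerHalfLargeImage/K1G11-SEARCH-LOG.md`)

HONEST FRAMING: the crux (the Eisenstein half of Kobayashi's signed main conjecture on the X7
large-image class) is OPEN and nothing here proves it for the class; BSD is not proved by any of
this. CONDITIONAL theorems: every non-proved input is a DISPLAYED binder — the PUBLISHED named facts
Kobayashi 2003 Thm. 1.2 (`h12`), the period-unit facts (`h5`, `h3`), the `p`-parity theorem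
(`hpar : p_parity W p`, Dokchitser–Dokchitser 2010 Thm. 1.4 / B. D. Kim 2007 at supersingular `p`),
Sprung's functional equation of the signed pair (`hFE : Sprung2017.cor414_sharpFlat_functionalEquation_apZero`,
ANT 11 (2017) Cor. 4.14, correcting Pollack 2003 Thm. 5.13) — and ONE per-pair certificate
"`μ(L_p^ε) = 0 ∧ λ(L_p^ε) ≤ 1`" (equivalently one Mazur–Tate element). CALIBRATION / SUPPORT
ONLY (pen rule D34-4 (3)): never an input to a registered stub, never a `closes`, never a by-name
close of the item. PER PAIR in its certificate; CLASS-WIDE in every other binder.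

## What this file does (K1G11 §4, made kernel)

The b2b rank-one squeeze (`Supersingular.kobayashiMainConjecture_of_lam_eq_one_of_analyticRank_eq_one`,
p213197; certificate form `SqueezeCertificates.lean`) and this crux's rank-one files get the
divisibility `T ∣ ξ^ε` (`ξ^ε` a characteristic power series of `X^ε = Sel^ε(E/ℚ_∞)^∨`) from
`ord_{s=1} L(E,s) = 1` through Gross–Zagier–Kolyvagin (`rank E(ℚ) = 1`) and the Mordell–Weil form
of control. Here `T ∣ ξ^ε` comes from PARITY instead, so that NO hypothesis on the analytic rank
(and no GZK) remains:

* §1 `sign_eq_neg_one_and_constantCoeff_eq_zero_of_subst_eq` — the elementary engine (pure algebra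
  in `Λ = ℤ_p⟦T⟧`, `p` odd): if `L₀ ≡ a₀ + a₁T + … ` has `p ∣ a₀`, `p ∤ a₁` (i.e. `λ = 1` after the
  `p`-power is removed) and satisfies `L₀(T^ι) = σ · u · L₀` with `σ = ±1`, `u(0) = 1`,
  `T^ι = (1+T)⁻¹ − 1`, then `σ = −1` AND `a₀ = 0` (compare the `T⁰`- and `T¹`-coefficients:
  `a₀ = σ a₀`, `−a₁ = σ(a₁ + u₁ a₀)`). This replaces the "pairing of zeros under `ι`, unique fixed
  point `0` for odd `p`" of Greenberg LNM 1716 §5 / K1G11 §4 by a two-coefficient computation.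
* §2 `rootNumber_eq_neg_one_and_X_dvd_of_lam_eq_one` — for the newform `f` of `E` AT THE CONDUCTOR
  LEVEL (the level over which `KobayashiLowerDivisibility` quantifies), a Pollack pair `(L⁺, L⁻)`
  and a sign `ε` with `λ(L_p^ε) = 1`: **`w(E) = −1` and `T ∣ L_p^ε`**, granted `hFE` — the sign of
  the signed functional equation at level `N_E` IS the root number (`rootNumber_eq_neg_frickeEigenvalue`,
  Atkin–Lehner `IsNewform0.frickeInvolution_eq_smul_holds`, tree theorems), its multiplier
  `(1+T)^{c+a}` has constant term `1`, and a Pollack pair is a Sprung pair for trace `0`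
  (`isSprungPair_zero_iff`).
* §3 `odd_selmerCorank_of_lam_eq_one`, `X_dvd_of_charIdeal_eq_span_of_lam_eq_one` — with
  `p_parity W p` (`(−1)^{corank Sel_{p^∞}(E/ℚ)} = w(E)`): the corank is odd, hence `≥ 1`, hence
  **`T ∣ ξ^{ε'}` for EVERY sign `ε'`** and every finitely generated torsion dual datum, by the new
  signed corank control `SignedSelmerDualData.X_pow_selmerCorank_dvd_of_charIdeal_eq_span` (p635263).
* §4 `kobayashiLowerDivisibility_of_lam_le_one` — **the Eisenstein half on the parity stratum**:
  odd good `p`, `a_p = 0`, `h12`, `h5`, `h3`, `hpar`, `hFE`, and for the newform `f₀` of level `N_E`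
  the certificate `μ(L) = 0 ∧ λ(L) ≤ 1` for every `L` that is Pollack's `L_p^ε` ⟹
  `KobayashiLowerDivisibility W p ε` (for `λ = 0`, `ϖ L_p^ε` is a unit of `Λ`; for `λ = 1`,
  `(ϖ L_p^ε) = (T) ⊇ (ξ^ε)`). NO image hypothesis, NO Kato, NO rank hypothesis.
* Companion file `…ParityStratumMainConjecture.lean`: the full signed main conjecture at a pair with
  certificate `(μ, λ)(L_p^ε) = (0, 1)` and surjective `ρ̄_{E,p}` (the b2b squeeze with
  `W.analyticRank = 1` + GZK REPLACED by parity), the Mazur–Tate-element forms, the X7 readings.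

What the stratum is (and is not): `{μ(L_p^ε) = 0, λ(L_p^ε) ≤ 1 for some ε}` is decidable per pair
from ONE Mazur–Tate element; conjecturally it is `{r_an ≤ 1 ∧ p ∤ #Ш·Tam·…}`-like, and its complement
(`λ ≥ 2` or `μ ≥ 1` for both signs: paired or transcendental zeros, positive `μ`) is the crux with
all its difficulty (K1G11 §2.2). So this is a SUPPORT lemma closing a stratum class-wide modulo
print, not a stub of the line of record `kurihara_rigidity` and not a shrinkage of the hard stub.

References: [Kobayashi2003] Thm. 1.2, Conjecture (p. 2), Thm. 4.1; [Pollack2003] Thm. 5.13,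
Prop. 6.18; [Sprung2017] Cor. 4.14, §3.5; [DokchitserDokchitserAnnals2010] Thm. 1.4; [BDKim2007];
[GreenbergLNM1716] §1 pp. 67–68, §3 Lemma 3.1, §5 p. 181; [GreenbergVatsal2000] p. 4; [Wuthrich2014]
Lemma 20. Crux dir: `K1G11-SEARCH-LOG.md` §4 (the suggestion), `LineReportKuriharaRigidity.md`.
-/

set_option autoImplicit false
set_option linter.dupNamespace false

noncomputable section

open scoped Classical MatrixGroups ModularForm

open CongruenceSubgroup PowerSeries WeierstrassCurve Literature.NumberTheory.EllipticCurves
  Literature.NumberTheory.EllipticCurves.ModularForms Literature.Barriers.BirchSwinnertonDyer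
  Literature.NumberTheory.EllipticCurves.Rank1Residual Literature.NumberTheory.EllipticCurves.Sprung2017
  Literature.NumberTheory.EllipticCurves.Kobayashi2003 ZpExtension
  Literature.NumberTheory.EllipticCurves.Rank1Residual.Typed
  Summit.BirchSwinnertonDyer.Rank1Residual.X1.MuLambda
  Summit.BirchSwinnertonDyer.Rank1Residual.Supersingular

namespace Summit.BirchSwinnertonDyer.BirchSwinnertonDyer.Theorems.LargeImageParityStratum

/-! ## §1. The engine: two coefficients of a functional equation in `ℤ_p⟦T⟧` -/

section Algebra

variable {p : ℕ} [Fact p.Prime]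

/-- **Two-coefficient rigidity of a signed functional equation (`p` odd).** Let `L ∈ Λ = ℤ_p⟦T⟧` with
`p ∣ a₀ = L(0)` and `p ∤ a₁ = [T¹]L` (so `λ(L) = 1`, `μ(L) = 0`), and suppose `L(T^ι) = σ · u · L`
with `(1+T)(1+T^ι) = 1`, `σ ∈ ℤ`, `σ² = 1`, `u(0) = 1`. Then `σ = −1` and `a₀ = 0` (i.e. `T ∣ L`):
the `T⁰`-coefficients give `a₀ = σ a₀`, the `T¹`-coefficients `−a₁ = σ (a₁ + u₁ a₀)`; `σ = 1`
would force `2a₁ ∈ pℤ_p`, impossible for odd `p`; so `σ = −1` and `2a₀ = 0`. (Greenberg, LNM 1716,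
§5 p. 181, "`(1+a)⁻¹ − 1` is also a root … `a = 0`", done on coefficients.)
[cite: GreenbergLNM1716, §5 (p. 181)] -/
theorem sign_eq_neg_one_and_constantCoeff_eq_zero_of_subst_eq {σ : ℤ} (hσ : σ ^ 2 = 1) (hp : p ≠ 2)
    {ι u L : IwasawaAlgebra p} (hι : (1 + X : IwasawaAlgebra p) * (ι + 1) = 1)
    (hu : constantCoeff u = 1)
    (h0 : (p : ℤ_[p]) ∣ constantCoeff L) (h1 : ¬ (p : ℤ_[p]) ∣ coeff 1 L)
    (hFE : L.subst ι = (σ : IwasawaAlgebra p) * u * L) :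
    σ = -1 ∧ constantCoeff L = 0 := by
  have hι0 : constantCoeff ι = 0 := constantCoeff_eq_zero_of_one_add_X_mul hι
  have hι1 : coeff 1 ι = -1 := by
    have h := congr_arg (coeff 1) hι
    simp only [mul_add, mul_one, add_mul, one_mul, map_add, coeff_one, if_neg one_ne_zero,
      coeff_one_X, coeff_succ_X_mul, coeff_zero_eq_constantCoeff, hι0] at h
    linear_combination h
  -- the two lowest coefficients of `L(T^ι)`
  have c0 : coeff 0 (L.subst ι) = constantCoeff L := by
    rw [coeff_subst_eq_sum_range hι0 L 0, Finset.sum_range_one, pow_zero, coeff_zero_one, one_mul,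
      coeff_zero_eq_constantCoeff]
  have c1 : coeff 1 (L.subst ι) = -coeff 1 L := by
    rw [coeff_subst_eq_sum_range hι0 L 1, Finset.sum_range_succ, Finset.sum_range_one, pow_zero,
      pow_one, coeff_one, if_neg one_ne_zero, zero_mul, zero_add, hι1, neg_one_mul]
  -- the two lowest coefficients of `u · L`
  have d0 : coeff 0 (u * L) = constantCoeff L := by
    rw [coeff_zero_eq_constantCoeff, map_mul, hu, one_mul]
  have d1 : coeff 1 (u * L) = coeff 1 L + coeff 1 u * constantCoeff L := by
    rw [coeff_mul, Finset.Nat.sum_antidiagonal_succ, Finset.Nat.antidiagonal_zero,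
      Finset.sum_singleton]
    show coeff 0 u * coeff 1 L + coeff 1 u * coeff 0 L = _
    rw [coeff_zero_eq_constantCoeff, hu, one_mul]
  -- `σ = ±1`; `p ∤ 2`
  have hσ' : σ = 1 ∨ σ = -1 := by
    have h : (σ - 1) * (σ + 1) = 0 := by linear_combination hσ
    rcases mul_eq_zero.mp h with h | h
    · left; linear_combination h
    · right; linear_combination h
  have hp2 : ¬ (p : ℤ_[p]) ∣ (2 : ℤ_[p]) := by
    intro h
    have h' : ‖((2 : ℤ) : ℤ_[p])‖ < 1 := by
      rw [PadicInt.norm_lt_one_iff_dvd]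
      exact_mod_cast h
    rw [PadicInt.norm_int_lt_one_iff_dvd] at h'
    have h2 : (p : ℤ) ∣ 2 := h'
    have : p ∣ 2 := by exact_mod_cast h2
    exact hp ((Nat.prime_dvd_prime_iff_eq (Fact.out : p.Prime) Nat.prime_two).mp this)
  rcases hσ' with rfl | rfl
  · -- `σ = 1`: `2 a₁ = -u₁ a₀ ∈ pℤ_p`, contradiction
    exfalso
    have e1 := congr_arg (coeff 1) hFE
    rw [c1, Int.cast_one, one_mul, d1] at e1
    apply h1
    have h2 : (2 : ℤ_[p]) * coeff 1 L = -(coeff 1 u * constantCoeff L) := by linear_combination -e1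
    have hdvd : (p : ℤ_[p]) ∣ 2 * coeff 1 L := by
      rw [h2]; exact (Dvd.dvd.mul_left h0 _).neg_right
    exact ((PadicInt.prime_p (p := p)).dvd_or_dvd hdvd).resolve_left hp2
  · -- `σ = -1`: `2 a₀ = 0`
    refine ⟨rfl, ?_⟩
    have e0 := congr_arg (coeff 0) hFE
    rw [c0, Int.cast_neg, Int.cast_one, neg_one_mul, neg_mul, map_neg, d0] at e0
    have h2 : (2 : ℤ_[p]) * constantCoeff L = 0 := by linear_combination e0
    exact (mul_eq_zero.mp h2).resolve_left two_ne_zero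

/-- `p + 1` is a unit of `ℤ_p`. [folklore] -/
theorem isUnit_natCast_add_one : IsUnit ((p : ℤ_[p]) + 1) := by
  have hpP : p.Prime := Fact.out
  rw [PadicInt.isUnit_iff]
  have hcast : ((p : ℤ_[p]) + 1) = (((p : ℤ) + 1 : ℤ) : ℤ_[p]) := by push_cast; rfl
  rw [hcast]
  refine le_antisymm (PadicInt.norm_le_one _) (not_lt.mp fun hlt ↦ ?_)
  rw [PadicInt.norm_int_lt_one_iff_dvd, Int.dvd_add_right (dvd_refl _)] at hlt
  have h1 : (p : ℤ) = 1 := Int.eq_one_of_dvd_one (by positivity) hlt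
  exact hpP.one_lt.ne' (by exact_mod_cast h1)

/-- The `p`-adic exponents of Sprung's unit factors `W⁺ = (1+T)^{-a}`, `W⁻ = (1+T)^{-b}` exist in
`ℤ_p`: `(p+1)·a = −p`, `(p+1)·b = −1` (the binders `a`, `b` of
`Sprung2017.cor414_sharpFlat_functionalEquation_apZero`). [cite: Sprung2017, §3.5 (W^±)] -/
theorem exists_sprung_exponents :
    ∃ a b : ℤ_[p], ((p : ℤ_[p]) + 1) * a = -(p : ℤ_[p]) ∧ ((p : ℤ_[p]) + 1) * b = -1 := by
  obtain ⟨v, hv⟩ := isUnit_natCast_add_one (p := p)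
  refine ⟨-(p : ℤ_[p]) * ↑v⁻¹, -↑v⁻¹, ?_, ?_⟩
  · rw [← hv, mul_comm, mul_assoc, Units.inv_mul, mul_one]
  · rw [← hv, mul_neg, Units.mul_inv]

end Algebra

/-! ## §2. At the conductor level: `λ(L_p^ε) = 1 ⇒ w(E) = −1 ∧ T ∣ L_p^ε` -/

section Sign

variable (W : WeierstrassCurve ℚ) [W.IsElliptic] [W.IsGloballyMinimal] (p : ℕ) [Fact p.Prime]

/-- **`λ(L_p^ε) = 1` at the conductor level forces `w(E) = −1` and `T ∣ L_p^ε`.** Let `p` be an odd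
good prime of `E = W` with `a_p = 0`, `f ∈ S₂(Γ₀(N_E))` its newform, `(L⁺, L⁻)` a Pollack pair of `f`
and `ε` a sign with `λ(L_p^ε) = 1` (`L_p^ε = kobayashiL ε L⁺ L⁻`, Kobayashi's labelling). Granted
Sprung's functional equation of the pair (`hFE`, Cor. 4.14 at `a_p = 0`: `L^•(T^ι) = σ (1+T)^{c+·} L^•`
with `w_N f = −σ f`): `W.rootNumber = -1` and `X ∣ L_p^ε`. Proof: at level `N_E` the Fricke sign is
`−w(E)` (`rootNumber_eq_neg_frickeEigenvalue` + Atkin–Lehner, tree theorems), so `σ = w(E)`; a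
Pollack pair is a Sprung pair for trace `0` (`isSprungPair_zero_iff`); write `L_p^ε = p^μ L₀` with
`L₀ ≢ 0 (mod p)`, so `λ = 1` reads `p ∣ L₀(0)`, `p ∤ [T¹]L₀`, cancel `p^μ` in the functional equation
and apply §1. CONDITIONAL on `hFE` (PUB named fact); nothing else assumed.
[cite: Sprung2017, Cor. 4.14 (a_p = 0 display) and §3.5] [cite: GreenbergLNM1716, §1 (pp. 67–68) and §5 (p. 181)]
[cite: Pollack2003, Prop. 6.18] -/
theorem rootNumber_eq_neg_one_and_X_dvd_of_lam_eq_one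
    (hFE : Sprung2017.cor414_sharpFlat_functionalEquation_apZero)
    (hp : p ≠ 2) (hgood : W.HasGoodReductionAtPrime p) (hap : W.frobeniusTrace p = 0)
    [NeZero (W.conductorNorm ℤ)] {f : CuspForm (Gamma0 (W.conductorNorm ℤ)) 2} (hf : IsNewformOf W f)
    {Lplus Lminus : IwasawaAlgebra p} (hPP : IsPollackPair f p Lplus Lminus) (ε : ℤˣ)
    (hlam : lam (kobayashiL ε Lplus Lminus) = 1) :
    W.rootNumber = -1 ∧ (X : IwasawaAlgebra p) ∣ kobayashiL ε Lplus Lminus := by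
  -- the sign dictionary at level `N_W`: `w_N f = -w(E) f`
  have hw : (W.rootNumber : ℂ) = -frickeEigenvalue f :=
    rootNumber_eq_neg_frickeEigenvalue (fun _ _ ↦ IsNewform0.exists_functional_equation_holds)
      (fun _ _ ↦ IsNewform0.frickeEigenvalue_eq_one_or_eq_neg_one_holds) hf
  have hsm := IsNewform0.frickeInvolution_eq_smul_holds (N := W.conductorNorm ℤ) (k := (2 : ℤ)) hf.1
  have hFr : IsFrickeEigen (W.conductorNorm ℤ) f (frickeEigenvalue f) :=
    isFrickeEigen_of_frickeInvolution_eq_smul _ hsm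
  have hWσ : IsFrickeEigen (W.conductorNorm ℤ) f (-((W.rootNumber : ℤ) : ℂ)) := by
    rw [hw, neg_neg]; exact hFr
  have hσ : W.rootNumber ^ 2 = 1 := by
    rcases W.rootNumber_eq_one_or with h | h <;> rw [h] <;> norm_num
  -- the exponent of `⟨N⟩`, the constants `a, b`, the Sprung pair
  have hpN : ¬ p ∣ W.conductorNorm ℤ := not_dvd_level_of_isNewformOf hf hgood
  obtain ⟨ηN, c, hc⟩ := exists_teichmuller_exponent_natCast p hpN
  obtain ⟨a, b, ha, hb⟩ := exists_sprung_exponents (p := p)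
  have hSP : IsSprungPair f p 0 Lplus Lminus :=
    (isSprungPair_zero_iff f p Lplus Lminus).mpr ⟨hPP.2.2.1, hPP.2.2.2⟩
  set ι : IwasawaAlgebra p := invOnePlusSubOne with hιdef
  have hι : (1 + X : IwasawaAlgebra p) * (ι + 1) = 1 := one_add_X_mul_invOnePlusSubOne_add_one
  obtain ⟨hs, hfl⟩ := hFE p W (W.conductorNorm ℤ) f hp hf hgood hap W.rootNumber hσ hWσ ηN c hc a b
    ha hb ι hι Lplus Lminus hSP
  -- the component of the sign `ε`
  set L := kobayashiL ε Lplus Lminus with hLdef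
  obtain ⟨e, he⟩ : ∃ e : ℤ_[p], L.subst ι =
      (W.rootNumber : IwasawaAlgebra p) * binomialSeries ℤ_[p] e * L := by
    rw [hLdef, kobayashiL]
    split_ifs
    · exact ⟨c + b, hfl⟩
    · exact ⟨c + a, hs⟩
  -- pass to the `p`-free part `L₀`: `L = p^μ L₀`, `λ(L) = ord_T (L₀ mod p) = 1`
  have hL0 : L ≠ 0 := ne_zero_of_lam_ne_zero (by rw [hlam]; exact one_ne_zero)
  set L₀ := pfree L with hL₀def
  have hdec : L = C ((p : ℤ_[p]) ^ mu L) * L₀ := eq_C_pow_mu_mul_pfree L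
  have hred : red L₀ ≠ 0 := red_pfree_ne_zero hL0
  have hord : (red L₀).order.toNat = 1 := hlam
  have h0 : (p : ℤ_[p]) ∣ constantCoeff L₀ := by
    have h : coeff 0 (red L₀) = 0 := coeff_of_lt_order_toNat 0 (by rw [hord]; exact one_pos)
    rw [coeff_map, coeff_zero_eq_constantCoeff, IsLocalRing.residue_eq_zero_iff,
      PadicInt.maximalIdeal_eq_span_p, Ideal.mem_span_singleton] at h
    exact h
  have h1 : ¬ (p : ℤ_[p]) ∣ coeff 1 L₀ := by
    intro h
    have hne : coeff 1 (red L₀) ≠ 0 := by rw [← hord]; exact coeff_order hred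
    apply hne
    rw [coeff_map, IsLocalRing.residue_eq_zero_iff, PadicInt.maximalIdeal_eq_span_p,
      Ideal.mem_span_singleton]
    exact h
  -- the functional equation of `L₀` (cancel `p^μ`) and the engine of §1
  have hι0 : constantCoeff ι = 0 := constantCoeff_eq_zero_of_one_add_X_mul hι
  have hsub : HasSubst ι := HasSubst.of_constantCoeff_zero' hι0
  have hFE₀ : L₀.subst ι = (W.rootNumber : IwasawaAlgebra p) * binomialSeries ℤ_[p] e * L₀ := by
    have h := he
    rw [hdec, ← smul_eq_C_mul, subst_smul hsub, mul_smul_comm, smul_eq_C_mul, smul_eq_C_mul] at h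
    exact mul_left_cancel₀ (C_pow_ne_zero (mu L)) h
  obtain ⟨hw1, hc0⟩ := sign_eq_neg_one_and_constantCoeff_eq_zero_of_subst_eq hσ hp hι
    (binomialSeries_constantCoeff (A := ℤ_[p]) e) h0 h1 hFE₀
  refine ⟨hw1, ?_⟩
  rw [hdec]
  exact Dvd.dvd.mul_left (X_dvd_iff.mpr hc0) _

end Sign

/-! ## §3. With `p`-parity: odd corank, and `T ∣ ξ^{ε'}` for every sign `ε'` -/

section Parity

variable (W : WeierstrassCurve ℚ) [W.IsElliptic] [W.IsGloballyMinimal] (p : ℕ) [Fact p.Prime]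

/-- **`λ(L_p^ε) = 1 ⇒ corank_{ℤ_p} Sel_{p^∞}(E/ℚ)` is odd**, granted the `p`-parity theorem
(`hpar : p_parity W p`, `(−1)^{corank} = w(E)`; Dokchitser–Dokchitser 2010 Thm. 1.4, at good
supersingular `p > 3` B. D. Kim 2007) and Sprung's functional equation (`hFE`): §2 gives `w(E) = −1`.
CONDITIONAL on the two named facts. [cite: DokchitserDokchitserAnnals2010, Thm. 1.4] [cite: BDKim2007]
[cite: Sprung2017, Cor. 4.14 (a_p = 0 display)] -/
theorem odd_selmerCorank_of_lam_eq_one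
    (hpar : p_parity W p) (hFE : Sprung2017.cor414_sharpFlat_functionalEquation_apZero)
    (hp : p ≠ 2) (hgood : W.HasGoodReductionAtPrime p) (hap : W.frobeniusTrace p = 0)
    [NeZero (W.conductorNorm ℤ)] {f : CuspForm (Gamma0 (W.conductorNorm ℤ)) 2} (hf : IsNewformOf W f)
    {Lplus Lminus : IwasawaAlgebra p} (hPP : IsPollackPair f p Lplus Lminus) (ε : ℤˣ)
    (hlam : lam (kobayashiL ε Lplus Lminus) = 1) : Odd (W.selmerCorank p) := by
  have hw := (rootNumber_eq_neg_one_and_X_dvd_of_lam_eq_one W p hFE hp hgood hap hf hPP ε hlam).1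
  have h : (-1 : ℤ) ^ W.selmerCorank p = W.rootNumber := hpar
  rw [hw] at h
  rcases (W.selmerCorank p).even_or_odd with he | ho
  · rw [he.neg_one_pow] at h; norm_num at h
  · exact ho

/-- **`λ(L_p^ε) = 1 ⇒ T ∣ ξ^{ε'}` for EVERY sign `ε'`**: with `hpar`, `hFE` as above, for any
`ℤ_p`-extension datum `(κ, γ)` and any Pontryagin-dual datum `D` of `Sel^{ε'}(E/ℚ_∞)` with `X^{ε'}`
finitely generated `Λ`-torsion and `Char(X^{ε'}) = (ξ)`: `X ∣ ξ` — odd corank (previous theorem) is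
`≥ 1`, and `T^{corank} ∣ ξ` by the signed corank control
(`SignedSelmerDualData.X_pow_selmerCorank_dvd_of_charIdeal_eq_span`, Greenberg's Lemma 3.1 on
Kobayashi's objects; no control theorem at `p`). The sign `ε'` of the Selmer group is independent of
the sign `ε` of the certificate. [cite: DokchitserDokchitserAnnals2010, Thm. 1.4]
[cite: GreenbergLNM1716, §1 p. 65 and §3 Lemma 3.1] [cite: Sprung2017, Cor. 4.14 (a_p = 0 display)] -/
theorem X_dvd_of_charIdeal_eq_span_of_lam_eq_one
    (hpar : p_parity W p) (hFE : Sprung2017.cor414_sharpFlat_functionalEquation_apZero)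
    (hp : p ≠ 2) (hgood : W.HasGoodReductionAtPrime p) (hap : W.frobeniusTrace p = 0)
    [NeZero (W.conductorNorm ℤ)] {f : CuspForm (Gamma0 (W.conductorNorm ℤ)) 2} (hf : IsNewformOf W f)
    {Lplus Lminus : IwasawaAlgebra p} (hPP : IsPollackPair f p Lplus Lminus) (ε : ℤˣ)
    (hlam : lam (kobayashiL ε Lplus Lminus) = 1)
    {κ : ZpExtension ℚ p} {γ : Field.absoluteGaloisGroup ℚ} (hγ : κ.IsTopGenerator γ) {ε' : ℤˣ}
    (D : SignedSelmerDualData W κ γ ε') [Module.Finite (IwasawaAlgebra p) D.X]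
    (hX : Module.IsTorsion (IwasawaAlgebra p) D.X) {ξ : IwasawaAlgebra p}
    (hξ : D.charIdeal = Ideal.span {ξ}) : (X : IwasawaAlgebra p) ∣ ξ := by
  have ho := odd_selmerCorank_of_lam_eq_one W p hpar hFE hp hgood hap hf hPP ε hlam
  have hpow := D.X_pow_selmerCorank_dvd_of_charIdeal_eq_span hγ hX hξ
  exact (dvd_pow_self _ (Nat.ne_of_gt ho.pos)).trans hpow

end Parity

/-! ## §4. The Eisenstein half on the parity stratum `{μ(L_p^ε) = 0, λ(L_p^ε) ≤ 1}` -/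

section LowerHalf

variable (W : WeierstrassCurve ℚ) [W.IsElliptic] [W.IsGloballyMinimal] (p : ℕ) [Fact p.Prime]

/-- **Kobayashi's Eisenstein half `KobayashiLowerDivisibility W p ε` on the parity stratum — NO rank
hypothesis, NO image hypothesis, NO Kato side.** Let `p` be an odd good prime of `E = W` with
`a_p = 0`, `ε` a sign, `f₀` the newform of level `N_E`, and suppose the per-pair certificate
`hcert₀`: `μ(L) = 0 ∧ λ(L) ≤ 1` for every `L ∈ Λ` that is Pollack's `L_p^ε` of `f₀`
(`IsSignedPAdicLFunction f₀ p ε`; one power series — e.g. from one Mazur–Tate element, §6). Granted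
BY NAME: Kobayashi 2003 Thm. 1.2 (`h12`: `X^ε` finitely generated torsion), the period-unit facts
(`h5`, `h3`: `ord_p(Ω⁺_f/Ω_E) = 0` at an irreducible odd good `p`), the `p`-parity theorem (`hpar`)
and Sprung's functional equation (`hFE`). Then for every `(κ, γ, f, ϖ, (L⁺,L⁻), D)` of the
conjecture's quantifier, `Char(X^ε) = (g)` with `ι g = ϖ · ι(L_p^ε · h)`: if `λ(L_p^ε) = 0` then
`ϖ L_p^ε ∈ Λ^×` divides `ξ^ε`; if `λ(L_p^ε) = 1` then `T ∣ L_p^ε` (§2) so `(L_p^ε) = (T)` (`μ = 0`),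
and `T ∣ ξ^ε` by parity (§3). CONDITIONAL on the displayed binders; PER PAIR in `hcert₀`, CLASS-FREE
otherwise (any reduction type away from `p`, any image). Calibration/support for crux 3 — not a stub
input. [cite: Kobayashi2003, Thm. 1.2 (p. 2) and Conjecture (p. 2)] [cite: DokchitserDokchitserAnnals2010, Thm. 1.4]
[cite: Sprung2017, Cor. 4.14 (a_p = 0 display)] [cite: GreenbergVatsal2000, p. 4 and §3 Remark 3.4] -/
theorem kobayashiLowerDivisibility_of_lam_le_one
    (h12 : Kobayashi2003.thm12_signedSelmerDual_finite_torsion)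
    (h5 : realPeriodRat_eq_unit_mul_plusPeriod) (h3 : realPeriodRat_eq_unit_mul_plusPeriod_three)
    (hpar : p_parity W p) (hFE : Sprung2017.cor414_sharpFlat_functionalEquation_apZero)
    (hp : p ≠ 2) (hgood : W.HasGoodReductionAtPrime p) (hap : W.frobeniusTrace p = 0) (ε : ℤˣ)
    [NeZero (W.conductorNorm ℤ)] {f₀ : CuspForm (Gamma0 (W.conductorNorm ℤ)) 2} (hf₀ : IsNewformOf W f₀)
    (hcert₀ : ∀ L : IwasawaAlgebra p, IsSignedPAdicLFunction f₀ p ε L → mu L = 0 ∧ lam L ≤ 1) :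
    KobayashiLowerDivisibility W p ε := by
  intro κ γ hκ hγ hγ' _ f hf ϖ hϖ Lplus Lminus hPP D
  -- the newform of the quantifier is `f₀`
  have hff : f = f₀ := hf.unique hf₀
  subst hff
  -- Thm. 1.2: `X^ε` finitely generated and torsion; a characteristic power series `ξ`
  haveI : Module.Finite (IwasawaAlgebra p) D.X := h12.moduleFinite hp hgood hap hκ hγ D
  have hX : Module.IsTorsion (IwasawaAlgebra p) D.X := h12.isTorsion hp hgood hap hκ hγ D
  obtain ⟨ξ, hξ⟩ := (charIdeal_isPrincipal_holds p D.X).principal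
  have hξ' : D.charIdeal = Ideal.span {ξ} := hξ
  -- Kobayashi's `L_p^ε` and its certificate
  set L := kobayashiL ε Lplus Lminus with hL_def
  have hL : IsSignedPAdicLFunction f p ε L := hPP.isSignedPAdicLFunction_kobayashiL ε
  obtain ⟨hμ, hlam⟩ := hcert₀ L hL
  -- `L ∣ ξ`: unit case `λ = 0`, or `(L) = (T) ⊇ (ξ)` in the case `λ = 1`
  have hL0 : L ≠ 0 := by
    rw [hL_def, kobayashiL]
    split_ifs
    · exact hPP.2.1
    · exact hPP.1
  have hLξ : L ∣ ξ := by
    rcases Nat.le_one_iff_eq_zero_or_eq_one.mp hlam with h0 | h1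
    · exact ((isUnit_iff_mu_eq_zero_and_lam_eq_zero L).mpr ⟨hL0, hμ, h0⟩).dvd
    · have hXL := (rootNumber_eq_neg_one_and_X_dvd_of_lam_eq_one W p hFE hp hgood hap hf hPP ε h1).2
      have hXξ := X_dvd_of_charIdeal_eq_span_of_lam_eq_one W p hpar hFE hp hgood hap hf hPP ε h1 hγ
        D hX hξ'
      have hspan : Ideal.span ({X} : Set (IwasawaAlgebra p)) = Ideal.span {L} :=
        span_eq_span_of_dvd_of_X_dvd_of_lam_eq_one hXL (dvd_refl _) hμ h1
      have hLX : L ∣ X := by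
        rw [← Ideal.mem_span_singleton, ← hspan]; exact Ideal.mem_span_singleton_self _
      exact hLX.trans hXξ
  obtain ⟨h, hh⟩ := hLξ
  -- the period ratio `ϖ` is a `p`-adic unit
  have hirr : W.HasIrreducibleModPGaloisRep p :=
    hasIrreducibleModPGaloisRep_of_dvd_frobeniusTrace W p hp
      (W.not_dvd_minimalDiscriminantInt_of_hasGoodReductionAtPrime' p hgood) (by rw [hap]; exact dvd_zero _)
  have hvϖ : padicValRat p ϖ = 0 := padicValRat_periodRatio_eq_zero h5 h3 W p hp hgood hirr f hf ϖ hϖ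
  have hϖ0 : ϖ ≠ 0 := by
    intro h0
    rw [h0, Rat.cast_zero, zero_mul] at hϖ
    exact (IsNewform0.plusPeriod_pos_holds hf.1 hf.coeffField_eq_bot).ne' hϖ.symm
  obtain ⟨u, hu⟩ := exists_units_coe_eq_ratCast hϖ0 hvϖ
  -- `ξ = (u L) · (u⁻¹ h)`, `ι(u L) = ϖ · ι L`
  refine ⟨ξ, C (((u⁻¹ : ℤ_[p]ˣ) : ℤ_[p])) * h, hξ', ?_⟩
  have e1 : ξ = (C (u : ℤ_[p]) * L) * (C (((u⁻¹ : ℤ_[p]ˣ) : ℤ_[p])) * h) := by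
    rw [hh, mul_mul_mul_comm, ← map_mul, Units.mul_inv, map_one, one_mul]
  rw [map_mul (iwasawaToPowerSeries p) L, e1, map_mul (iwasawaToPowerSeries p) (C (u : ℤ_[p]) * L),
    (span_C_units_mul_eq u L).2, hu, mul_assoc]

end LowerHalf

end Summit.BirchSwinnertonDyer.BirchSwinnertonDyer.Theorems.LargeImageParityStratum

end
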